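import Summits.QuantumFields.YangMills.Theorems.UnitScaleTiltProp8FlatCubeSequenceAligned
import Literature.MathematicalPhysics.QuantumFieldTheory.Balaban1983to89.B8Eq131Cubes
import Literature.MathematicalPhysics.QuantumFieldTheory.Balaban1983to89.B10Eq27TorusAxialLog
import Literature.MathematicalPhysics.QuantumFieldTheory.Balaban1983to89.Node00.TorusCoverLevels
import HarnessLib

/-!
# Route `UnitScaleTilt`, crux K1 child «MinimiserStabilityRegPr» (stmt-QuantumFields-19200), registered stub `stub_halvingStep` (H) — pillar P1♭ `core′`,
# LEAD-H T2♭-PLAN v1.1 junction **J1b (RULINGS L-3 (D) ∕ L-5 (D1)): THE CUBE-INCLUSION DICTIONARY route ⊆ N05** — the levelwise inclusions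
# `□_j^{route} ⊆ □_j^{N05}` of the route's big-block-aligned cube sequence into pub-ymgap N05's Dirichlet cube tower, read on ℤ³ representatives through r15's
# universal cover, with existence ∕ uniqueness of representatives in the window and the cell dictionary `Bʲ(cover z) = Bʲ(cover z′) ↔ ⌊z/Lʲ⌋ = ⌊z′/Lʲ⌋`

Cell `ym3-torus` ∕ `pub/ym-inputs`, seat `ym-inputs-p09`.  `--supports stmt-QuantumFields-19200 --as helper`; THEOREMS ONLY (0 `def`, 0 `sorry`); count-neutral; nothing
here claims the stub, the crux, d = 4 or the mass gap — YM₃ on T³ is a ladder rung (R3), not the Clay problem.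

WHY (LEAD-H RULING L-5 (D1)).  Proposition 5 ∕ `core′` is run at pub-ymgap N05's OWN Dirichlet cube member `B8Eq131CubesAdmissible.cubeFam false L a M′ ρ′ k`
(letters ✓`B8Eq191FlatLettersCubeMember.exists_flatLetters_cubeMember`, bounds ✓`Ineq159FlatCubeMemberPrinted`, knit ✓`B8SockHFPCubeMemberRD.sockHFP_pair_cubeMemberRD`),
and the route's rows on its big-block-aligned cube sequence `FlatCubeSequenceAligned.cubeSetM x₀ k ρ S M` (`k = K − n`) are transported along LEVELWISE INCLUSIONS
`□_j^{route} ⊆ □_j^{N05}`.  The two towers are different sets (route: `M`-saturated sup-balls of radius `radM L M ρ S (k−j)` about `Bʲx₀` on the torus,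
`radM (i+1) = L·radM i + (L·M − 1) + S`; N05: boxes of ℤ³ with margin `ρ′·gs L (k−j)` about `Lᵏ⁻ʲ·[a, a + M′ − 1]`, `gs L (i+1) = L·gs L i + 1`), so the inclusion
is an INEQUALITY of margins plus a no-wrap dictionary between torus sites and integer points.

WHAT IS PROVED (all def-free; CONSUMED BY NAME: `FlatCubeSequenceAligned.cubeSetM ∕ cubeFinM ∕ radM ∕ dist_le_of_mem_cubeFinM`, `B8Eq131Cubes.cube ∕ sqLo ∕ sqHi ∕
gs ∕ flm ∕ mem_cube_iff ∕ under_flm ∕ margin_own`, r15's `B15Eq112TorusCover.cover ∕ lift`, n07's `Node00.coverAt ∕ iterBlockOf_cover`, J3's `B10Eq27TorusAxialLog.transl ∕ rel`):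
* §1 `radM_add_le_gs`: `radM L M ρ S i + M ≤ ρ′·gs L i + 1` for all `i`, as soon as `ρ + M ≤ ρ′ + 1` and `L + S + M ≤ ρ′ + 2`.
* §2 integer bookkeeping; §3 `transl_zero_valRep_add_rel` ∕ `transl_zero_eq_cover` ∕ `cover_lift_add_rel` (the window representative `lift x₀ + rel x₀ s`
  covers `s`; J3's base-point-`0` translate `transl 0` IS r15's `cover`); ★★`mem_cube_of_cover_mem_cubeSetM` (set form `preimage_cubeSetM_inter_subset_cube`): for `j ≤ k ≤ m + K`, `1 ≤ M`, `ρ + M ≤ ρ′ + 1`, `L + S + M ≤ ρ′ + 2`,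
  a corner with `a ≤ Bᵏx₀ ≤ a + M′ − 1` (labels of `iterBlockOf k x₀`) and the no-wrap premise `2·(Lᵏ·(M′+1) + ρ′·gs L k) ≤ sitesPerDir 0`:
  `z ∈ cube L a M′ ρ′ k 0 → cover z ∈ cubeSetM x₀ k ρ S M j → z ∈ cube L a M′ ρ′ k j`;  ★`lift_add_rel_mem_cube_zero` (no room premise),
  `eq_of_cover_eq_of_mem_cube_zero`, `existsUnique_rep`: every site of `□₀^{route}` has exactly one representative in `□₀^{N05}`;  ★`iterBlockOf_cover_eq_iff_flm_eq`:
  the cell dictionary for (iv);  `corner_of_offset` (the corner hypothesis is satisfiable for every `M′ ≥ 1`), `room_of_level_k` (LEAD-H L-4's room binder in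
  level-`k` units, `2·(M′ + 1 + 2ρ′) ≤ sitesPerDir k`, implies the no-wrap premise).
PARAMETERS are binders, not definitions: any `ρ′ ≥ max (ρ + M − 1) (L + S + M − 2)`, any `M′ ≥ 1`, any admissible corner `a` (J5 ∕ ★w7-19936 g4 choose
`M′ = Lˢ ≥ 8` for dag-n05-c's `M_h`).  HONEST SCOPE: geometry bookkeeping between two cube towers; nothing here proves `core′`, the stub or the crux.

References: T. Bałaban, CMP **99** (1985) 75–102 [Balaban1985RegularSpaces] ((1.131) p.99, p.98 «□_j ⊃ □_{j+1} …»); CMP **102** (1985) 277–309 [Balaban1985Variational]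
((144) p.300); CMP **96** (1984) 223–250 [Balaban1984PropagatorsII] ((2.1) p.224).
-/

set_option autoImplicit false

namespace Summit.QuantumFields.YangMills.Theorems.P1FlatCoreCubeInclusion

open Literature.MathematicalPhysics.QuantumFieldTheory.Balaban1983to89
open Literature.MathematicalPhysics.QuantumFieldTheory.Balaban1983to89.B8Eq131Cubes (gs gs_zero gs_succ margin_own)
open Summit.QuantumFields.YangMills.Theorems.FlatCubeSequenceAligned (radM radM_succ)

/-! ## §1 The margin arithmetic: the route's radii are dominated by N05's margins -/

/-- **THE MARGIN DOMINATION** `radM L M ρ S i + M ≤ ρ′·gs L i + 1` for every `i`, provided `ρ + M ≤ ρ′ + 1` and `L + S + M ≤ ρ′ + 2` (`1 ≤ L`, `1 ≤ M`):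
the route's `M`-saturated radius at depth `i` plus the saturation slack `M − 1` stays inside N05's margin `ρ′·Σ_{t ≤ i} Lᵗ`.  Induction: step
`L·(radM i + M) + S + M − 1 ≤ L·(ρ′·gs i + 1) + ρ′ + 1 − L… = ρ′·gs (i+1) + 1`. [cite: Balaban1985RegularSpaces, p.98; Balaban1985Variational, (144) p.300] -/
theorem radM_add_le_gs (L M ρ S ρ' : ℕ) (hL : 1 ≤ L) (hM : 1 ≤ M) (h0 : ρ + M ≤ ρ' + 1) (h1 : L + S + M ≤ ρ' + 2) :
    ∀ i : ℕ, radM L M ρ S i + M ≤ ρ' * gs L i + 1 := by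
  intro i
  induction i with
  | zero => simpa [radM, gs_zero] using h0
  | succ i ih =>
    rw [radM_succ, gs_succ]
    have hLM : 1 ≤ L * M := Nat.one_le_iff_ne_zero.mpr (Nat.mul_ne_zero (by omega) (by omega))
    have h2 : L * (radM L M ρ S i + M) ≤ L * (ρ' * gs L i + 1) := Nat.mul_le_mul_left _ ih
    have h3 : L * radM L M ρ S i + (L * M - 1) + S + M + 1 ≤ L * (ρ' * gs L i) + L + S + M := by
      have := Nat.mul_add L (radM L M ρ S i) M; have := Nat.mul_add L (ρ' * gs L i) 1; omega
    have : L * (ρ' * gs L i) = ρ' * (L * gs L i) := by ring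
    nlinarith [h3, h1, this]

/-! ## §2 Integer bookkeeping: nested floors, circular versus integer distance, the label box -/

section IntArith

/-- **NESTED FLOORS**: if `q·c ≤ v < q·(c+1)` and `(q·qᵢ)·cₖ ≤ v < (q·qᵢ)·(cₖ+1)` (`0 < q`) then `qᵢ·cₖ ≤ c ≤ qᵢ·cₖ + qᵢ − 1` — the level-`j` block label
of a site lies in the `Lⁱ`-block of labels of its level-`k` block label (`q = Lʲ`, `qᵢ = Lⁱ`, `i = k − j`). [folklore] -/
theorem nest_of_floor {q qi c ck v : ℤ} (hq : 0 < q) (h1 : q * c ≤ v ∧ v + 1 ≤ q * (c + 1))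
    (h2 : q * qi * ck ≤ v ∧ v + 1 ≤ q * qi * (ck + 1)) : qi * ck ≤ c ∧ c ≤ qi * ck + qi - 1 := by
  obtain ⟨h1a, h1b⟩ := h1; obtain ⟨h2a, h2b⟩ := h2
  constructor
  · have h : q * (qi * ck) < q * (c + 1) := by nlinarith
    have := lt_of_mul_lt_mul_left h hq.le; omega
  · have h : q * c < q * (qi * ck + qi) := by nlinarith
    have := lt_of_mul_lt_mul_left h hq.le; omega

/-- **FLOORS OF NEARBY INTEGERS**: `q·w ≤ z < q·(w+1)`, `q·c ≤ v < q·(c+1)`, `|z − v| ≤ D` ⟹ `q·|w − c| < D + q`. [folklore] -/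
theorem mul_abs_sub_lt_of_floor {q w c z v D : ℤ} (hw : q * w ≤ z ∧ z + 1 ≤ q * (w + 1)) (hc : q * c ≤ v ∧ v + 1 ≤ q * (c + 1))
    (hD : |z - v| ≤ D) : q * |w - c| < D + q := by
  obtain ⟨hw1, hw2⟩ := hw; obtain ⟨hc1, hc2⟩ := hc
  obtain ⟨hD1, hD2⟩ := abs_le.1 hD
  rcases le_or_gt c w with h | h
  · rw [abs_of_nonneg (by omega)]; nlinarith
  · rw [abs_of_neg (by omega)]; nlinarith

/-- **CIRCULAR DISTANCE IS THE INTEGER DISTANCE BELOW HALF THE PERIOD**: if the least-absolute-value residue of `δ` modulo `N` has size `≤ R` and `2·|δ| < N`,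
then `|δ| ≤ R` (indeed `δ` IS its own least residue). [folklore] -/
theorem abs_le_of_natAbs_valMinAbs_le {N : ℕ} [NeZero N] {δ : ℤ} {R : ℕ} (hcirc : (((δ : ZMod N)).valMinAbs).natAbs ≤ R)
    (hnear : 2 * |δ| < N) : |δ| ≤ (R : ℤ) := by
  set vm : ℤ := ((δ : ZMod N)).valMinAbs with hvm
  have h1 : ((vm : ℤ) : ZMod N) = ((δ : ℤ) : ZMod N) := by rw [hvm, ZMod.coe_valMinAbs]
  have hdvd : (N : ℤ) ∣ δ - vm := (ZMod.intCast_eq_intCast_iff_dvd_sub vm δ N).1 h1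
  have h2 : (vm.natAbs : ℤ) ≤ ((N / 2 : ℕ) : ℤ) := by exact_mod_cast ZMod.natAbs_valMinAbs_le (n := N) (δ : ZMod N)
  rw [Int.natCast_natAbs] at h2
  have h2' : 2 * |vm| ≤ (N : ℤ) := by omega
  have h3 : |δ - vm| < N := by
    have e1 := le_abs_self δ; have e2 := neg_abs_le δ; have e3 := le_abs_self vm; have e4 := neg_abs_le vm
    rw [abs_lt]; constructor <;> linarith
  have hδ : δ = vm := by linarith [Int.eq_zero_of_abs_lt_dvd hdvd h3]
  have h4 : (vm.natAbs : ℤ) ≤ R := by exact_mod_cast hcirc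
  rw [Int.natCast_natAbs] at h4
  exact hδ ▸ h4

/-- **THE LABEL BOX AT DEPTH `i`**: a label `w` within `R ≤ G` of `c`, where `c` lies in the `qᵢ`-block of `cₖ ∈ [a, a + M′ − 1]`, lies in
`[qᵢ·a − G, qᵢ·(a + M′) − 1 + G]` (`0 ≤ qᵢ`). [cite: Balaban1985RegularSpaces, p.98 («□_j ⊃ □_{j+1} …»), bookkeeping] -/
theorem label_mem_box {qi a ck c w R G M' : ℤ} (hqi : 0 ≤ qi) (hck : qi * ck ≤ c ∧ c ≤ qi * ck + qi - 1) (ha : a ≤ ck ∧ ck ≤ a + M' - 1)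
    (hw : |w - c| ≤ R) (hRG : R ≤ G) : qi * a - G ≤ w ∧ w ≤ qi * (a + M') - 1 + G := by
  obtain ⟨hw1, hw2⟩ := abs_le.1 hw; obtain ⟨hc1, hc2⟩ := hck
  have m1 : qi * a ≤ qi * ck := mul_le_mul_of_nonneg_left ha.1 hqi
  have m2 : qi * ck ≤ qi * (a + M' - 1) := mul_le_mul_of_nonneg_left ha.2 hqi
  have e : qi * (a + M' - 1) = qi * (a + M') - qi := by ring
  constructor <;> linarith

end IntArith

/-! ## §3 Representatives of torus sites, THE LEVELWISE INCLUSION route ⊆ N05, uniqueness, cells -/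

section Inclusion

open B7Prop1Explicit renaming Site → LSite
open B7Prop1Local (InBox)
open B8Ineq132 (Under)
open B8Eq131Cubes (cube mem_cube_iff flm under_flm sqLo sqHi bLo bHi)
open B15Eq112TorusCover (cover cover_apply lift cover_lift)
open Node00 (coverAt coverAt_apply iterBlockOf_cover)
open Literature.MathematicalPhysics.QuantumLattice (blockMap)
open B5Eq118OneStroke (iterBlockOf iterBlockOf_zero val_iterBlockOf)
open B5Prop12FieldsLattice (distSite)
open B5Eq117TorusCarriers (Mk sitesPerDir_zero_eq)
open Summit.QuantumFields.YangMills.Theorems.FlatCubeSequenceAligned (cubeSetM cubeFinM dist_le_of_mem_cubeFinM)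
open B10Eq27TorusAxialLog (transl transl_apply transl_add transl_rel rel rel_apply)

variable {P : Params} {j : ℕ}

/-- `transl 0 (val y) = y`: the canonical coordinates represent the site from the origin. [cite: Balaban1987RG1, (0.1) p.252, bookkeeping] -/
theorem transl_zero_valRep (y : Site P j) : transl (0 : Site P j) (fun ν => ((y ν).val : ℤ)) = y := by
  funext ν
  rw [transl_apply, show (0 : Site P j) ν = 0 from rfl, zero_add]
  simp

/-- **THE WINDOW REPRESENTATIVE**: `transl 0 (val x + rel x s) = s` — the integer point `val x + rel x s` (the centre's canonical coordinates plus the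
least-absolute-value relative position of `s`) represents `s` from the origin. [cite: Balaban1987RG1, (0.1) p.252, bookkeeping] -/
theorem transl_zero_valRep_add_rel (x s : Site P j) : transl (0 : Site P j) ((fun ν => ((x ν).val : ℤ)) + rel x s) = s := by
  rw [transl_add, transl_zero_valRep, transl_rel]

/-- J3's base-point-`0` translate IS r15's universal cover: `transl 0 z = cover z`. [cite: Balaban1987RG1, (0.1) p.251, bookkeeping] -/
theorem transl_zero_eq_cover (z : LSite P.d) : transl (0 : Site P 0) z = cover P z := by
  funext ν
  rw [transl_apply, cover_apply]
  exact zero_add _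

/-- `blockMap (Lᵐ) = flm L m` (the two spellings of the `Lᵐ`-block label map on ℤᵈ). [folklore] -/
theorem blockMap_pow_eq_flm {d : ℕ} (L m : ℕ) (x : LSite d) : blockMap (L ^ m) x = flm L m x := by
  funext i
  simp [blockMap, flm, Nat.cast_pow]

/-- coordinate extraction from a `distSite` bound with natural radius. [cite: Balaban1984PropagatorsI, Prop. 1.2 (1.110) p.35, bookkeeping] -/
theorem natAbs_valMinAbs_le_of_distSite_le {j : ℕ} {y y' : Site P j} {R : ℕ} (h : distSite (Mk P j) y y' ≤ (R : ℝ)) (ν : Fin P.d) :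
    ((y ν - y' ν).valMinAbs).natAbs ≤ R := by
  unfold distSite at h
  have hsup : (Finset.univ.sup fun μ : Fin P.d => ((y μ - y' μ).valMinAbs).natAbs) ≤ R := by exact_mod_cast h
  exact le_trans (Finset.le_sup (f := fun μ : Fin P.d => ((y μ - y' μ).valMinAbs).natAbs) (Finset.mem_univ ν)) hsup

/-- the route's real radius `radM + (M − 1)` is the natural number `radM + (M − 1)` (`1 ≤ M`). [folklore] -/
theorem radM_real_eq (L M ρ S i : ℕ) (hM : 1 ≤ M) :
    (radM L M ρ S i : ℝ) + ((M : ℝ) - 1) = ((radM L M ρ S i + (M - 1) : ℕ) : ℝ) := by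
  push_cast [Nat.cast_sub hM]
  ring

/-- the `k`-block label `Bᵏx₀` of the centre is the floor `⌊x₀/Lᵏ⌋` of its canonical coordinates (`k ≤ m + K`). [cite: Balaban1984PropagatorsI, (1.18) p.20] -/
theorem kBlock_floor {k : ℕ} (hk : k ≤ P.m + P.K) (x₀ : Site P 0) (ν : Fin P.d) :
    (P.L : ℤ) ^ k * ((iterBlockOf k x₀ ν).val : ℤ) ≤ lift P x₀ ν ∧ lift P x₀ ν + 1 ≤ (P.L : ℤ) ^ k * (((iterBlockOf k x₀ ν).val : ℤ) + 1) := by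
  have hck := val_iterBlockOf k hk x₀ ν
  have hn1 : P.L ^ k * (iterBlockOf k x₀ ν).val ≤ (x₀ ν).val := by rw [hck]; exact Nat.mul_div_le _ _
  have hn2 : (x₀ ν).val < P.L ^ k * ((iterBlockOf k x₀ ν).val + 1) := by rw [hck]; exact Nat.lt_mul_div_succ _ (pow_pos P.L_pos k)
  unfold lift; exact ⟨by exact_mod_cast hn1, by exact_mod_cast hn2⟩

/-- two points of N05's level-`0` cube differ by at most `Lᵏ·M′ − 1 + 2·ρ′·gs L k` coordinatewise. [cite: Balaban1985RegularSpaces, p.98, bookkeeping] -/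
theorem abs_sub_le_of_mem_cube_zero {k : ℕ} {a : LSite P.d} {M' ρ' : ℕ} {z z' : LSite P.d} (hz : z ∈ cube P.L a M' ρ' k 0)
    (hz' : z' ∈ cube P.L a M' ρ' k 0) (ν : Fin P.d) : |z' ν - z ν| ≤ (P.L : ℤ) ^ k * (M' : ℤ) - 1 + 2 * ((ρ' : ℤ) * (gs P.L k : ℤ)) := by
  have h1 := hz ν; have h2 := hz' ν
  simp only [B8Ineq130.tlo, B8Ineq130.thi, sqLo, sqHi, bLo, bHi, Nat.sub_zero] at h1 h2
  obtain ⟨l1, u1⟩ := h1; obtain ⟨l2, u2⟩ := h2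
  push_cast at l1 u1 l2 u2
  have e1 : (P.L : ℤ) ^ k * (a ν + (M' : ℤ)) = (P.L : ℤ) ^ k * a ν + (P.L : ℤ) ^ k * (M' : ℤ) := by ring
  rw [abs_le]
  constructor <;> linarith

/-- ★★ **THE LEVELWISE INCLUSION `□_j^{route} ⊆ □_j^{N05}` ON REPRESENTATIVES** (`j ≤ k ≤ m + K`, `1 ≤ M`).  Let the N05 parameters dominate the route's:
`ρ + M ≤ ρ′ + 1`, `L + S + M ≤ ρ′ + 2`, let the corner `a` put the window's `k`-block `Bᵏx₀` in the top box, `a ≤ Bᵏx₀ ≤ a + M′ − 1` (labels = `ZMod.val` of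
`iterBlockOf k x₀`), and let the level-`0` N05 cube fit twice in the torus, `2·(Lᵏ·(M′+1) + ρ′·gs L k) ≤ sitesPerDir 0` (no wrap).  Then every integer point `z` of
N05's level-`0` cube `cube L a M′ ρ′ k 0` whose torus image `cover z` lies in the route's level-`j` cube `cubeSetM x₀ k ρ S M j` lies in N05's level-`j` cube
`cube L a M′ ρ′ k j`.  Proof: the level-`j` label `⌊z/Lʲ⌋` is within circular distance `radM (k−j) + M − 1` of `⌊x₀/Lʲ⌋` (route membership read through
`iterBlockOf_cover`), the no-wrap premise makes that the integer distance, §1 bounds it by N05's margin `ρ′·gs L (k−j)`, and `⌊x₀/Lʲ⌋` lies in the `L^{k−j}`-block of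
`Bᵏx₀ ∈ [a, a + M′ − 1]`. [cite: Balaban1985RegularSpaces, (1.131) p.99, p.98 («□_j ⊃ □_{j+1} and a distance between boundaries of these cubes is equal to R₁M₁Lʲη»);
Balaban1985Variational, (144) p.300; Balaban1984PropagatorsII, (2.1) p.224] -/
theorem mem_cube_of_cover_mem_cubeSetM {x₀ : Site P 0} {k : ℕ} (hk : k ≤ P.m + P.K) {ρ S M : ℕ} (hM : 1 ≤ M)
    {a : LSite P.d} {M' ρ' : ℕ} (h0 : ρ + M ≤ ρ' + 1) (h1 : P.L + S + M ≤ ρ' + 2)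
    (ha : ∀ ν, a ν ≤ ((iterBlockOf k x₀ ν).val : ℤ) ∧ ((iterBlockOf k x₀ ν).val : ℤ) ≤ a ν + M' - 1)
    (hroom : 2 * (P.L ^ k * (M' + 1) + ρ' * gs P.L k) ≤ P.sitesPerDir 0)
    {j : ℕ} (hjk : j ≤ k) {z : LSite P.d} (hz0 : z ∈ cube P.L a M' ρ' k 0) (hzj : cover P z ∈ cubeSetM x₀ k ρ S M j) :
    z ∈ cube P.L a M' ρ' k j := by
  have hL : 1 ≤ P.L := P.L_pos; have hjm : j ≤ P.m + P.K := le_trans hjk hk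
  rw [mem_cube_iff hL]
  refine ⟨flm P.L j z, ?_, under_flm hL j z⟩
  have hy : iterBlockOf j (cover P z) ∈ cubeFinM x₀ k ρ S M j := by
    simpa only [cubeSetM, hjk, if_true, Set.mem_setOf_eq] using hzj
  have hdist := dist_le_of_mem_cubeFinM hM hy
  have hx₀ : iterBlockOf j x₀ = coverAt P j (flm P.L j (lift P x₀)) := by
    rw [← blockMap_pow_eq_flm, ← iterBlockOf_cover hjm (lift P x₀), cover_lift]
  rw [iterBlockOf_cover hjm z, blockMap_pow_eq_flm, hx₀, radM_real_eq _ _ _ _ _ hM] at hdist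
  have hmargin := radM_add_le_gs P.L M ρ S ρ' hL hM h0 h1 (k - j)
  have hN0 : P.sitesPerDir 0 = P.L ^ j * P.sitesPerDir j := sitesPerDir_zero_eq hjm
  have hkj : P.L ^ k = P.L ^ j * P.L ^ (k - j) := by rw [← pow_add, Nat.add_sub_cancel' hjk]
  intro ν
  have hcirc := natAbs_valMinAbs_le_of_distSite_le hdist ν
  rw [coverAt_apply, coverAt_apply, ← Int.cast_sub] at hcirc
  have hwz := under_flm hL j z ν; have hcv := under_flm hL j (lift P x₀) ν
  have hkz : (P.L : ℤ) ^ k = (P.L : ℤ) ^ j * (P.L : ℤ) ^ (k - j) := by exact_mod_cast hkj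
  have hv := kBlock_floor hk x₀ ν
  have hz1 := hv; rw [hkz] at hz1
  have hq : (0 : ℤ) < (P.L : ℤ) ^ j := by positivity
  have hnest := nest_of_floor hq hcv hz1
  -- the level-`0` N05 cube and the window centre: `|z ν − x₀ ν| ≤ Lᵏ·M′ − 1 + ρ′·gs L k`
  have hz00 := hz0 ν
  simp only [B8Ineq130.tlo, B8Ineq130.thi, sqLo, sqHi, bLo, bHi, Nat.sub_zero] at hz00
  have hD : |z ν - lift P x₀ ν| ≤ (P.L : ℤ) ^ k * (M' : ℤ) - 1 + (ρ' : ℤ) * (gs P.L k : ℤ) := by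
    have hQ : (0 : ℤ) ≤ (P.L : ℤ) ^ k := by positivity
    obtain ⟨hl, hu⟩ := hz00
    push_cast at hl hu
    obtain ⟨ha1, ha2⟩ := ha ν
    have m1 : (P.L : ℤ) ^ k * a ν ≤ (P.L : ℤ) ^ k * ((iterBlockOf k x₀ ν).val : ℤ) := mul_le_mul_of_nonneg_left ha1 hQ
    have m2 : (P.L : ℤ) ^ k * ((iterBlockOf k x₀ ν).val : ℤ) ≤ (P.L : ℤ) ^ k * (a ν + M' - 1) := mul_le_mul_of_nonneg_left ha2 hQ
    obtain ⟨hv1, hv2⟩ := hv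
    have e1 : (P.L : ℤ) ^ k * (a ν + M' - 1) = (P.L : ℤ) ^ k * a ν + (P.L : ℤ) ^ k * (M' : ℤ) - (P.L : ℤ) ^ k := by ring
    have e2 : (P.L : ℤ) ^ k * (((iterBlockOf k x₀ ν).val : ℤ) + 1) = (P.L : ℤ) ^ k * ((iterBlockOf k x₀ ν).val : ℤ) + (P.L : ℤ) ^ k := by ring
    have e3 : (P.L : ℤ) ^ k * (a ν + (M' : ℤ)) = (P.L : ℤ) ^ k * a ν + (P.L : ℤ) ^ k * (M' : ℤ) := by ring
    rw [abs_le]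
    constructor <;> linarith
  -- no wrap: `2·|w − c| < sitesPerDir j`
  have hnear : 2 * |flm P.L j z ν - flm P.L j (lift P x₀) ν| < (P.sitesPerDir j : ℤ) := by
    have key := mul_abs_sub_lt_of_floor hwz hcv hD
    rw [hN0] at hroom
    have hr : (2 : ℤ) * ((P.L : ℤ) ^ k * ((M' : ℤ) + 1) + (ρ' : ℤ) * (gs P.L k : ℤ)) ≤ (P.L : ℤ) ^ j * (P.sitesPerDir j : ℤ) := by
      exact_mod_cast hroom
    have hjk' : (P.L : ℤ) ^ j ≤ (P.L : ℤ) ^ k := by exact_mod_cast Nat.pow_le_pow_right P.L_pos hjk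
    have hG : (0 : ℤ) ≤ (ρ' : ℤ) * (gs P.L k : ℤ) := by positivity
    have e1 : (P.L : ℤ) ^ k * ((M' : ℤ) + 1) = (P.L : ℤ) ^ k * (M' : ℤ) + (P.L : ℤ) ^ k := by ring
    have h2 : (P.L : ℤ) ^ j * (2 * |flm P.L j z ν - flm P.L j (lift P x₀) ν|) < (P.L : ℤ) ^ j * (P.sitesPerDir j : ℤ) := by
      have e2 : (P.L : ℤ) ^ j * (2 * |flm P.L j z ν - flm P.L j (lift P x₀) ν|) = 2 * ((P.L : ℤ) ^ j * |flm P.L j z ν - flm P.L j (lift P x₀) ν|) := by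
        ring
      rw [e2]
      linarith
    exact lt_of_mul_lt_mul_left h2 hq.le
  have habs := abs_le_of_natAbs_valMinAbs_le hcirc hnear
  have hRG : ((radM P.L M ρ S (k - j) + (M - 1) : ℕ) : ℤ) ≤ ((ρ' * gs P.L (k - j) : ℕ) : ℤ) := by have := hmargin; omega
  have hqi : (0 : ℤ) ≤ (P.L : ℤ) ^ (k - j) := by positivity
  simp only [sqLo, sqHi, bLo, bHi]
  exact label_mem_box hqi hnest (ha ν) habs hRG

/-- **SET FORM OF THE LEVELWISE INCLUSION**: inside N05's level-`0` cube, the pull-back of the route's level-`j` cube along the cover is contained in N05's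
level-`j` cube. [cite: Balaban1985RegularSpaces, (1.131) p.99; Balaban1984PropagatorsII, (2.1) p.224] -/
theorem preimage_cubeSetM_inter_subset_cube {x₀ : Site P 0} {k : ℕ} (hk : k ≤ P.m + P.K) {ρ S M : ℕ} (hM : 1 ≤ M)
    {a : LSite P.d} {M' ρ' : ℕ} (h0 : ρ + M ≤ ρ' + 1) (h1 : P.L + S + M ≤ ρ' + 2)
    (ha : ∀ ν, a ν ≤ ((iterBlockOf k x₀ ν).val : ℤ) ∧ ((iterBlockOf k x₀ ν).val : ℤ) ≤ a ν + M' - 1)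
    (hroom : 2 * (P.L ^ k * (M' + 1) + ρ' * gs P.L k) ≤ P.sitesPerDir 0) {j : ℕ} (hjk : j ≤ k) :
    cover P ⁻¹' cubeSetM x₀ k ρ S M j ∩ cube P.L a M' ρ' k 0 ⊆ cube P.L a M' ρ' k j :=
  fun _ hz => mem_cube_of_cover_mem_cubeSetM hk hM h0 h1 ha hroom hjk hz.2 hz.1

/-- **THE WINDOW REPRESENTATIVE COVERS ITS SITE**: `cover (lift x₀ + rel x₀ s) = s`. [cite: Balaban1987RG1, (0.1) p.251, bookkeeping] -/
theorem cover_lift_add_rel (x₀ s : Site P 0) : cover P (lift P x₀ + rel x₀ s) = s := by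
  rw [← transl_zero_eq_cover]
  exact transl_zero_valRep_add_rel x₀ s

/-- ★ **THE WINDOW REPRESENTATIVE OF A SITE OF THE ROUTE'S LEVEL-`0` CUBE LIES IN N05's LEVEL-`0` CUBE** (`k ≤ m + K`, `1 ≤ M`, `ρ + M ≤ ρ′ + 1`,
`L + S + M ≤ ρ′ + 2`, `a ≤ Bᵏx₀ ≤ a + M′ − 1`; no room premise needed): `lift x₀ + rel x₀ s ∈ cube L a M′ ρ′ k 0` — its coordinates are within
`radM k + M − 1 ≤ ρ′·gs L k` of the centre's, and the centre's lie in the `Lᵏ`-block of `Bᵏx₀ ∈ [a, a + M′ − 1]`.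
[cite: Balaban1985RegularSpaces, p.98 («we take a size of □ equal to MLʲη»); Balaban1985Variational, (144) p.300] -/
theorem lift_add_rel_mem_cube_zero {x₀ : Site P 0} {k : ℕ} (hk : k ≤ P.m + P.K) {ρ S M : ℕ} (hM : 1 ≤ M)
    {a : LSite P.d} {M' ρ' : ℕ} (h0 : ρ + M ≤ ρ' + 1) (h1 : P.L + S + M ≤ ρ' + 2)
    (ha : ∀ ν, a ν ≤ ((iterBlockOf k x₀ ν).val : ℤ) ∧ ((iterBlockOf k x₀ ν).val : ℤ) ≤ a ν + M' - 1)
    {s : Site P 0} (hs : s ∈ cubeSetM x₀ k ρ S M 0) : lift P x₀ + rel x₀ s ∈ cube P.L a M' ρ' k 0 := by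
  have hL : 1 ≤ P.L := P.L_pos
  have hy : iterBlockOf 0 s ∈ cubeFinM x₀ k ρ S M 0 := by
    simpa only [cubeSetM, Nat.zero_le, if_true, Set.mem_setOf_eq] using hs
  have hdist := dist_le_of_mem_cubeFinM hM hy
  rw [iterBlockOf_zero, iterBlockOf_zero, Nat.sub_zero, radM_real_eq _ _ _ _ _ hM] at hdist
  have hmargin := radM_add_le_gs P.L M ρ S ρ' hL hM h0 h1 k
  have hRG : ((radM P.L M ρ S k + (M - 1) : ℕ) : ℤ) ≤ ((ρ' * gs P.L k : ℕ) : ℤ) := by have := hmargin; omega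
  simp only [cube, Set.mem_setOf_eq]
  intro ν
  simp only [B8Ineq130.tlo, B8Ineq130.thi, sqLo, sqHi, bLo, bHi, Nat.sub_zero]
  have hcirc := natAbs_valMinAbs_le_of_distSite_le hdist ν
  have h4 : ((((s ν - x₀ ν).valMinAbs).natAbs : ℕ) : ℤ) ≤ ((radM P.L M ρ S k + (M - 1) : ℕ) : ℤ) := by exact_mod_cast hcirc
  rw [Int.natCast_natAbs] at h4
  have hw : |(lift P x₀ + rel x₀ s) ν - lift P x₀ ν| ≤ ((radM P.L M ρ S k + (M - 1) : ℕ) : ℤ) := by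
    rw [Pi.add_apply, rel_apply, add_sub_cancel_left]
    exact h4
  obtain ⟨hv1, hv2⟩ := kBlock_floor hk x₀ ν
  have hv : (P.L : ℤ) ^ k * ((iterBlockOf k x₀ ν).val : ℤ) ≤ lift P x₀ ν ∧
      lift P x₀ ν ≤ (P.L : ℤ) ^ k * ((iterBlockOf k x₀ ν).val : ℤ) + (P.L : ℤ) ^ k - 1 :=
    ⟨hv1, by linarith [mul_add ((P.L : ℤ) ^ k) ((iterBlockOf k x₀ ν).val : ℤ) 1]⟩
  have hQ : (0 : ℤ) ≤ (P.L : ℤ) ^ k := by positivity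
  exact label_mem_box hQ hv (ha ν) hw hRG

/-- **UNIQUENESS OF REPRESENTATIVES IN N05's LEVEL-`0` CUBE** under the no-wrap premise `2·(Lᵏ·(M′+1) + ρ′·gs L k) ≤ sitesPerDir 0`: two integer points
of `cube L a M′ ρ′ k 0` with the same torus image are equal. [cite: Balaban1987RG1, (0.1) p.251; Balaban1985RegularSpaces, p.98, bookkeeping] -/
theorem eq_of_cover_eq_of_mem_cube_zero {k : ℕ} {a : LSite P.d} {M' ρ' : ℕ}
    (hroom : 2 * (P.L ^ k * (M' + 1) + ρ' * gs P.L k) ≤ P.sitesPerDir 0)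
    {z z' : LSite P.d} (hz : z ∈ cube P.L a M' ρ' k 0) (hz' : z' ∈ cube P.L a M' ρ' k 0) (h : cover P z = cover P z') : z = z' := by
  funext ν
  have hν : ((z ν : ℤ) : ZMod (P.sitesPerDir 0)) = ((z' ν : ℤ) : ZMod (P.sitesPerDir 0)) := by
    have := congrFun h ν
    rwa [cover_apply, cover_apply] at this
  have hdvd : ((P.sitesPerDir 0 : ℕ) : ℤ) ∣ z' ν - z ν := (ZMod.intCast_eq_intCast_iff_dvd_sub (z ν) (z' ν) _).1 hν
  have hD := abs_sub_le_of_mem_cube_zero hz hz' ν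
  have hr : (2 : ℤ) * ((P.L : ℤ) ^ k * ((M' : ℤ) + 1) + (ρ' : ℤ) * (gs P.L k : ℤ)) ≤ (P.sitesPerDir 0 : ℤ) := by exact_mod_cast hroom
  have e2 : (P.L : ℤ) ^ k * ((M' : ℤ) + 1) = (P.L : ℤ) ^ k * (M' : ℤ) + (P.L : ℤ) ^ k := by ring
  have hQ : (0 : ℤ) ≤ (P.L : ℤ) ^ k := by positivity
  have hM'0 : (0 : ℤ) ≤ (P.L : ℤ) ^ k * (M' : ℤ) := by positivity
  have hlt : |z' ν - z ν| < (P.sitesPerDir 0 : ℤ) := by linarith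
  have h0 := Int.eq_zero_of_abs_lt_dvd hdvd hlt
  linarith

/-- ★ **EXISTENCE AND UNIQUENESS OF THE REPRESENTATIVE**: under the hypotheses of the inclusion, every site of the route's level-`0` cube `□₀^{route}` has exactly
one integer representative in N05's level-`0` cube `□₀^{N05} = cube L a M′ ρ′ k 0`, namely `lift x₀ + rel x₀ s`.
[cite: Balaban1985RegularSpaces, p.98; Balaban1987RG1, (0.1) p.251, bookkeeping] -/
theorem existsUnique_rep {x₀ : Site P 0} {k : ℕ} (hk : k ≤ P.m + P.K) {ρ S M : ℕ} (hM : 1 ≤ M)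
    {a : LSite P.d} {M' ρ' : ℕ} (h0 : ρ + M ≤ ρ' + 1) (h1 : P.L + S + M ≤ ρ' + 2)
    (ha : ∀ ν, a ν ≤ ((iterBlockOf k x₀ ν).val : ℤ) ∧ ((iterBlockOf k x₀ ν).val : ℤ) ≤ a ν + M' - 1)
    (hroom : 2 * (P.L ^ k * (M' + 1) + ρ' * gs P.L k) ≤ P.sitesPerDir 0)
    {s : Site P 0} (hs : s ∈ cubeSetM x₀ k ρ S M 0) : ∃! z : LSite P.d, z ∈ cube P.L a M' ρ' k 0 ∧ cover P z = s := by
  refine ⟨lift P x₀ + rel x₀ s, ⟨lift_add_rel_mem_cube_zero hk hM h0 h1 ha hs, cover_lift_add_rel x₀ s⟩, ?_⟩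
  rintro z ⟨hz, hzs⟩
  exact eq_of_cover_eq_of_mem_cube_zero hroom hz (lift_add_rel_mem_cube_zero hk hM h0 h1 ha hs) (hzs.trans (cover_lift_add_rel x₀ s).symm)

/-- ★ **CELLS (the refinement input for (iv))**: inside N05's level-`0` cube and under the no-wrap premise, two representatives have the same level-`j` torus block
iff they have the same level-`j` integer label: `Bʲ(cover z) = Bʲ(cover z′) ↔ ⌊z/Lʲ⌋ = ⌊z′/Lʲ⌋` (`j ≤ k ≤ m + K`).
[cite: Balaban1984PropagatorsI, (1.18) p.20; Balaban1987RG1, (0.1) p.251, bookkeeping] -/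
theorem iterBlockOf_cover_eq_iff_flm_eq {k : ℕ} (hk : k ≤ P.m + P.K) {a : LSite P.d} {M' ρ' : ℕ}
    (hroom : 2 * (P.L ^ k * (M' + 1) + ρ' * gs P.L k) ≤ P.sitesPerDir 0) {j : ℕ} (hjk : j ≤ k)
    {z z' : LSite P.d} (hz : z ∈ cube P.L a M' ρ' k 0) (hz' : z' ∈ cube P.L a M' ρ' k 0) :
    iterBlockOf j (cover P z) = iterBlockOf j (cover P z') ↔ flm P.L j z = flm P.L j z' := by
  have hL : 1 ≤ P.L := P.L_pos; have hjm : j ≤ P.m + P.K := le_trans hjk hk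
  rw [iterBlockOf_cover hjm z, iterBlockOf_cover hjm z', blockMap_pow_eq_flm, blockMap_pow_eq_flm]
  constructor
  · intro h
    funext ν
    have hν : ((flm P.L j z ν : ℤ) : ZMod (P.sitesPerDir j)) = ((flm P.L j z' ν : ℤ) : ZMod (P.sitesPerDir j)) := by
      have := congrFun h ν
      rwa [coverAt_apply, coverAt_apply] at this
    have hdvd : ((P.sitesPerDir j : ℕ) : ℤ) ∣ flm P.L j z' ν - flm P.L j z ν := (ZMod.intCast_eq_intCast_iff_dvd_sub _ _ _).1 hν
    have hN0 : P.sitesPerDir 0 = P.L ^ j * P.sitesPerDir j := sitesPerDir_zero_eq hjm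
    rw [hN0] at hroom
    have hr : (2 : ℤ) * ((P.L : ℤ) ^ k * ((M' : ℤ) + 1) + (ρ' : ℤ) * (gs P.L k : ℤ)) ≤ (P.L : ℤ) ^ j * (P.sitesPerDir j : ℤ) := by
      exact_mod_cast hroom
    have hjk' : (P.L : ℤ) ^ j ≤ (P.L : ℤ) ^ k := by exact_mod_cast Nat.pow_le_pow_right P.L_pos hjk
    have hq : (0 : ℤ) < (P.L : ℤ) ^ j := by positivity
    have hD := abs_sub_le_of_mem_cube_zero hz hz' ν
    have e2 : (P.L : ℤ) ^ k * ((M' : ℤ) + 1) = (P.L : ℤ) ^ k * (M' : ℤ) + (P.L : ℤ) ^ k := by ring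
    have hM'0 : (0 : ℤ) ≤ (P.L : ℤ) ^ k * (M' : ℤ) := by positivity
    have key := mul_abs_sub_lt_of_floor (under_flm hL j z' ν) (under_flm hL j z ν) hD
    have h3 : (P.L : ℤ) ^ j * |flm P.L j z' ν - flm P.L j z ν| < (P.L : ℤ) ^ j * (P.sitesPerDir j : ℤ) := by linarith
    have hlt := lt_of_mul_lt_mul_left h3 hq.le
    have h0 := Int.eq_zero_of_abs_lt_dvd hdvd hlt
    linarith
  · intro h
    rw [h]

/-- **CORNERS EXIST** (`1 ≤ M′`): for every offset `0 ≤ t ≤ M′ − 1` the corner `a := Bᵏx₀ − t` puts the window's `k`-block in the top box `[a, a + M′ − 1]` — the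
hypothesis `ha` of the inclusion is satisfiable for every `M′ ≥ 1` (J5 picks `M′ = Lˢ ≥ 8` and the offset). [cite: Balaban1985RegularSpaces, p.98, bookkeeping] -/
theorem corner_of_offset (x₀ : Site P 0) (k : ℕ) {M' : ℕ} {t : ℤ} (ht0 : 0 ≤ t) (ht : t ≤ (M' : ℤ) - 1) :
    ∀ ν, (fun μ => ((iterBlockOf k x₀ μ).val : ℤ) - t) ν ≤ ((iterBlockOf k x₀ ν).val : ℤ) ∧
      ((iterBlockOf k x₀ ν).val : ℤ) ≤ (fun μ => ((iterBlockOf k x₀ μ).val : ℤ) - t) ν + M' - 1 := by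
  intro ν; constructor <;> simp only <;> linarith

/-- **THE ROOM PREMISE IN LEVEL-`k` UNITS** (`k ≤ m + K`): `2·(M′ + 1 + 2ρ′) ≤ sitesPerDir k` implies the no-wrap premise
`2·(Lᵏ·(M′+1) + ρ′·gs L k) ≤ sitesPerDir 0` (`ρ′·gs L k ≤ 2ρ′·Lᵏ`, `sitesPerDir 0 = Lᵏ·sitesPerDir k`) — LEAD-H L-4's room binder `2ρ + N_r ≤ |T^{(k)}|` with
`N_r := 2M′ + 4ρ′ + 2 − 2ρ`. [cite: Balaban1985RegularSpaces, p.98; Balaban1984PropagatorsI, (1.18) p.20, bookkeeping] -/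
theorem room_of_level_k {k : ℕ} (hk : k ≤ P.m + P.K) {M' ρ' : ℕ} (h : 2 * (M' + 1 + 2 * ρ') ≤ P.sitesPerDir k) :
    2 * (P.L ^ k * (M' + 1) + ρ' * gs P.L k) ≤ P.sitesPerDir 0 := by
  have hL2 : 2 ≤ P.L := by have := P.hL.2; omega
  have hm := margin_own (ρ := ρ') hL2 k
  rw [sitesPerDir_zero_eq hk]
  have h2 := Nat.mul_le_mul_left (P.L ^ k) h
  have e : P.L ^ k * (2 * (M' + 1 + 2 * ρ')) = 2 * (P.L ^ k * (M' + 1) + P.L ^ k * (2 * ρ')) := by ring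
  rw [e] at h2
  omega

end Inclusion

end Summit.QuantumFields.YangMills.Theorems.P1FlatCoreCubeInclusion
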